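import Mathlib
import Summits.QuantumFields.YangMills.Theorems.CoarseStiffnessTailCappedCoarseStiffnessLPressureConvexity
import Summits.QuantumFields.YangMills.Theorems.CoarseStiffnessTailCappedCoarseStiffnessLTorusPartitionRatio
import Literature.MathematicalPhysics.QuantumFieldTheory.Balaban1983to89.TorusGeometry

/-!
# Route `CoarseStiffnessTail` — THE BARE (`j = 0`) FACES OF THE CRUX HOLD ON EVERY COMPACT COUPLING RANGE, UNIFORMLY IN THE CUT-OFF
# AND THE VOLUME (lead's certificate, seat `ym-line-cst-p1` g14; helper on 25301 `CappedCoarseStiffnessL`)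

THE THEOREMS (three-torus families `F` of [Balaban1985UV3]: `2L^{m+K}` sites per direction, `SU(2)` Wilson–Gibbs law `Gibbs_K` at inverse
coupling `β_K = (γL^{−K})⁻¹`; `#Plaq_0` = number of fine plaquettes, `n_K = 2L^{m+K}`).
§2 WITH TOTAL LOGARITHMIC SLACK — one absolute constant `A`, all `F`, `0 < γ ≤ 1`, `K`, `0 ≤ c₀ ≤ 1/8`:
* ★ `exists_bareStiffness_le`: `∫ exp(c₀·β_K·Σ_a|U(∂a) − 1|²) dGibbs_K ≤ exp(A·#Plaq_0 + (3/2)·(#Plaq_0/n_K)·log β_K)` (UNCAPPED bare stiffness);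
* ★ `exists_crux0_le` / `exists_bulk0_le`: the same bound for the crux's capped tilt `Σ_a min(|U(∂a) − 1|², θ(K)²)` (the `j = 0` instance of
  `CappedCoarseStiffnessL`) and for the sub-threshold tilt `Σ_a |U(∂a) − 1|²·1[|U(∂a) − 1| < θ(K)]` (the `j = 0` instance of the registered BULK
  stub `stub_subThresholdStiffness`), every profile `(b₀, p₀)`;
* ★ `exists_meanSqSum_le`: `β_K·∫Σ_a|U(∂a) − 1|² dGibbs_K ≤ 8A·#Plaq_0 + 12·(#Plaq_0/n_K)·log β_K` (mean plaquette energy).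
Since `#Plaq_0/n_K = 12L^{2(m+K)}` and `log β_K = K·log L + log γ⁻¹`, the slack PER PLAQUETTE `(3/2)·log β_K/n_K → 0` along the continuum
limit `K → ∞` at every fixed `γ` (the tree's `bare_logStiffness`, g4, had `(3/2)·log β_K` per plaquette, which diverges with `K`).
§3 ON COMPACT COUPLING RANGES — for every `γ_lo > 0` constants `c₀ = 1/8`, `C₀(γ_lo)` serving ALL `F` (any `L`, any volume exponent `m`),
all `γ ∈ [γ_lo, 1]`, all profiles and ALL cut-offs `K`:
* ★★ `crux0_compactCoupling`: `∫ exp(c₀·β_K·Σ_a min(|U(∂a) − 1|², θ(K)²)) dGibbs_K ≤ exp(C₀·#Plaq_0)`;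
* ★★ `bulk0_compactCoupling`, ★★ `ubs_compactCoupling` (uncapped), ★★ `uma_compactCoupling` (`β_K·⟨Σ|U(∂a) − 1|²⟩ ≤ C·#Plaq_0`).

PROOF.  `Σ|U(∂a) − 1|² ≤ 4A(U)` on `SU(2)` (tree (11)), so the uncapped moment is `≤ ∫e^{4c₀β_K·A}dGibbs_{β_K} = Z(β_K(1 − 4c₀))/Z(β_K)`
(`CoarseStiffnessTailPressureConvexity.integral_exp_mul_action_eq`); the companion file's partition RATIO
(`CoarseStiffnessTailTorusPartitionRatio.exists_log_partitionFn_ratio_le` at `N = 2`, `d = 3`, `β' = (1 − 4c₀)β_K ≥ β_K/2`: the N13 seats'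
axial-tree upper bound and layered Faddeev–Popov lower bound subtracted) bounds its logarithm by `3|T|·log 2 + (9/2)(|T|/n_K)·log β_K + 9E|T|`,
and `#Plaq_0 = 3|T|`.  Capped and sub-threshold tilts are dominated pointwise; the mean by Jensen.  On `[γ_lo, 1]`:
`log β_K = K log L + log γ⁻¹ ≤ (1 + max(log γ_lo⁻¹, 0))·L^{m+K} = (1 + max(log γ_lo⁻¹, 0))·n_K/2` (`K log L ≤ L^{K+1} ≤ L^{m+K}`, `m ≥ 1`).

WHAT IT SAYS (line card `Cruxes/CappedCoarseStiffnessL/Lines/birth.md` §g14; no claim about Bałaban's estimates).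
* The bare faces `crux₀`, `BULK₀` and the classical letter UMA (uniform mean action; g12: `crux₀ ⇔ BULK₀ ⇔ UBS ⇔ UMA` in the crux's uniform
  quantifier block) HOLD AT EVERY FIXED TERMINAL COUPLING `γ`, UNIFORMLY IN THE CUT-OFF `K` AND THE VOLUME `m` — and uniformly on compacts
  `[γ_lo, 1]`.  g9 proved the bare EDGE face with the crux's γ-uniform constants; g12 reduced the bare BULK face to torus-UMA and located
  its only non-elementary regime as `log β_K ≫ #Plaq_0`; this file PROVES the bare BULK face everywhere outside the sharper corner
  `log β_K ≳ n_K`, i.e. `log γ⁻¹ ≳ 2L^{m+K}` — super-weak BARE coupling on a FIXED lattice, which is not the continuum limit (`K → ∞` at fixed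
  `γ`) and is read by no consumer of the route (g12).  What the crux's typing asks beyond this file at `j = 0` is only `∃ C₀ ∀ γ ≤ γ₁`
  instead of `∀ γ_lo ∃ C₀`: the uniform Laplace exponent of the fixed-lattice Wilson integral as `β → ∞` (g2/g12 memos), a statement with
  no renormalisation-group content.
* Planner note: re-typing the crux (and its consumers' constants) as `∀ γ ∈ (0, γ₁] ∃ (c₀, C₀)` — constants allowed to depend on the terminal
  coupling, as they do in [Balaban1985UV3] ("O(1) … for g_k in a bounded set", p.257) — makes the whole `j = 0` face a theorem of the tree
  (this file + g9's `bare_uniformLargeFieldCount`); the located content of 25301 is then exactly the `j ≥ 1` uniformity (g13: non-decay of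
  the joint Peierls rate in the depth; [Balaban1985UV3] (71) integrated).

HONEST SCOPE.  Elementary: two landed partition-function bounds, convexity bookkeeping, real arithmetic.  The crux 25301 (both registered stubs
at `j ≥ 1`, and the `γ → 0` corner at `j = 0`), `HistoryTailL` 19936 and every rung above stay OPEN; nothing of Bałaban's (41)/(47)/(71) is
asserted; `YM3TorusSU2` (R3, RECORD rung, not Clay) is NOT proved; the Yang–Mills mass gap is NOT touched.

References: T. Bałaban, CMP **102** (1985) 255–275 [Balaban1985UV3] ((1)–(3) p.256; (11) p.258; p.257 "O(1) independent of ε, k, g_k in a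
bounded set"); T. Bałaban, CMP **109** (1987) 249–301 [Balaban1987RG1] ((0.14) p.254).
-/

noncomputable section

namespace Summit.QuantumFields.YangMills.Theorems.CoarseStiffnessTailBareCompactCoupling

open MeasureTheory ProbabilityTheory Finset
open Literature.MathematicalPhysics.QuantumFieldTheory
open Literature.MathematicalPhysics.QuantumFieldTheory.Balaban1983to89
open Literature.MathematicalPhysics.QuantumFieldTheory.Balaban1983to89.T3ContinuumYM3Torus
open Literature.MathematicalPhysics.QuantumFieldTheory.Balaban1983to89.T3UnitScaleTilt
open Literature.MathematicalPhysics.QuantumFieldTheory.Balaban1983to89.T3UnitLawDensityEML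
open Literature.MathematicalPhysics.QuantumFieldTheory.Balaban1983to89.Missing
open Literature.MathematicalPhysics.QuantumFieldTheory.Balaban1983to89.T3UpperLiftSplit (scheme_β_eq)
open Summit.QuantumFields.YangMills.Theorems.CoarseStiffnessTailPressureConvexity
open Summit.QuantumFields.YangMills.Theorems.CoarseStiffnessTailTorusPartitionRatio (exists_log_partitionFn_ratio_le)

/-! ## §2 Bałaban's three-tori, `SU(2)`: the bare stiffness with TOTAL logarithmic slack `(3/2)·(#Plaq_0/n_K)·log β_K` -/

section Bare

variable (F : T3Family)

/-- `#Plaq_0 = 3·|T₁^{(0)}|` in `d = 3` (three coordinate planes per site). [folklore] -/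
theorem card_plaq_zero_eq (K : ℕ) : (Fintype.card (Plaq (F.P K) 0) : ℝ) = 3 * (Fintype.card (Site (F.P K) 0) : ℝ) := by
  have h3 : Fintype.card {x : Fin (F.P K).d × Fin (F.P K).d // x.1 < x.2} = 3 := by
    rw [T3Family.P_d]; decide
  rw [T4StabilityFloor.card_plaq, ← Site.card_site, h3]
  push_cast; ring

/-- **★ THE UNCAPPED BARE STIFFNESS WITH TOTAL LOGARITHMIC SLACK.**  There is an absolute constant `A` such that for every three-torus
family `F`, every `0 < γ ≤ 1`, every cut-off `K` and every `0 ≤ c₀ ≤ 1/8`: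
`∫ exp(c₀·β_K·Σ_a |U(∂a) − 1|²) dGibbs_K ≤ exp(A·#Plaq_0 + (3/2)·(#Plaq_0/n_K)·log β_K)`, `n_K = 2L^{m+K}` the number of sites per direction.
(`Σ|U(∂a) − 1|² ≤ 4A(U)`; `∫e^{tA}dGibbs_β = Z(β − t)/Z(β)`; §1 at `β' = (1 − 4c₀)β ≥ β/2`.)  Since `#Plaq_0/n_K = 12·L^{2(m+K)}` while
`log β_K = K log L + log γ⁻¹`, the slack per plaquette `(3/2)·log β_K/n_K` TENDS TO ZERO along the continuum limit `K → ∞` at every fixed `γ`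
(compare the tree's `bare_logStiffness`: `(3/2)·log β_K` per plaquette). [folklore] -/
theorem exists_bareStiffness_le :
    ∃ A : ℝ, 0 ≤ A ∧ ∀ (F : T3Family) (γ : ℝ), 0 < γ → γ ≤ 1 → ∀ (K : ℕ) (c₀ : ℝ), 0 ≤ c₀ → c₀ ≤ 1 / 8 →
      ∫ U, Real.exp (c₀ * (γ * ((F.L : ℝ)⁻¹) ^ K)⁻¹ * ∑ a : Plaq (F.P K) 0, dist1 (GaugeField.plaqHol U a) ^ 2) ∂(gibbsK F ℰp γ K) ≤
        Real.exp (A * (Fintype.card (Plaq (F.P K) 0) : ℝ) +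
          3 / 2 * ((Fintype.card (Plaq (F.P K) 0) : ℝ) * ((F.P K).sitesPerDir 0 : ℝ)⁻¹) * Real.log (γ * ((F.L : ℝ)⁻¹) ^ K)⁻¹) := by
  obtain ⟨E, hE0, hE⟩ := exists_log_partitionFn_ratio_le 2
  refine ⟨Real.log 2 + 3 * E, by positivity, fun F γ hγ hγ1 K c₀ hc₀ hc₀' => ?_⟩
  set β : ℝ := (γ * ((F.L : ℝ)⁻¹) ^ K)⁻¹ with hβdef
  set nP : ℝ := (Fintype.card (Plaq (F.P K) 0) : ℝ) with hnP
  set r : ℝ := ((F.P K).sitesPerDir 0 : ℝ)⁻¹ with hr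
  have hβ1 : 1 ≤ β := by
    have hL1 : (1 : ℝ) ≤ F.L := by exact_mod_cast F.hL.2.le
    have hx0 : 0 < ((F.L : ℝ)⁻¹) ^ K := pow_pos (inv_pos.2 (by linarith)) K
    have hx : ((F.L : ℝ)⁻¹) ^ K ≤ 1 := pow_le_one₀ (inv_nonneg.2 (by linarith)) (inv_le_one_of_one_le₀ hL1)
    exact (one_le_inv₀ (mul_pos hγ hx0)).2 (by nlinarith)
  have hβ0 : 0 < β := lt_of_lt_of_le one_pos hβ1
  haveI := isProbabilityMeasure_gibbsK F ℰp hγ.le K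
  have hnP3 : nP = 3 * (Fintype.card (Site (F.P K) 0) : ℝ) := card_plaq_zero_eq F K
  have hV0 : (0 : ℝ) ≤ (Fintype.card (Site (F.P K) 0) : ℝ) := Nat.cast_nonneg _
  have hr0 : 0 ≤ r := inv_nonneg.2 (Nat.cast_nonneg _)
  -- Step 1: pointwise `exp(c₀βΣd²) ≤ exp((4c₀β)·A)`
  set t : ℝ := 4 * c₀ * β with ht
  have ht0 : 0 ≤ t := by positivity
  have htβ : t ≤ β / 2 := by rw [ht]; nlinarith
  have hpt : ∀ U : GaugeField (F.P K) 0 (Matrix.specialUnitaryGroup (Fin 2) ℂ),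
      Real.exp (c₀ * β * ∑ a : Plaq (F.P K) 0, dist1 (GaugeField.plaqHol U a) ^ 2) ≤ Real.exp (t * wilsonAction4 U) := fun U => by
    refine Real.exp_le_exp.mpr ?_
    have h4 := sqSum_le_four_mul_action F U
    have hcb : 0 ≤ c₀ * β := by positivity
    calc c₀ * β * ∑ a : Plaq (F.P K) 0, dist1 (GaugeField.plaqHol U a) ^ 2 ≤ c₀ * β * (4 * wilsonAction4 U) :=
          mul_le_mul_of_nonneg_left h4 hcb
      _ = t * wilsonAction4 U := by rw [ht]; ring
  -- Step 2: integrate; `∫ e^{tA} dGibbs_β = Z(β − t)/Z(β)`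
  have hint : Integrable (fun U : GaugeField (F.P K) 0 (Matrix.specialUnitaryGroup (Fin 2) ℂ) => Real.exp (t * wilsonAction4 U))
      (gibbsK F ℰp γ K) := by
    refine integrable_of_bounded ((measurable_wilsonAction4 RegularGaugeGroup.measurable_reTr).const_mul _).exp
      (M := Real.exp (t * (2 * nP))) fun U => ?_
    rw [abs_of_pos (Real.exp_pos _)]
    obtain ⟨h0, h2⟩ := wilsonAction4_mem U
    exact Real.exp_le_exp.mpr (mul_le_mul_of_nonneg_left h2 ht0)
  have hstep : ∫ U, Real.exp (c₀ * β * ∑ a : Plaq (F.P K) 0, dist1 (GaugeField.plaqHol U a) ^ 2) ∂(gibbsK F ℰp γ K) ≤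
      partitionFn (G := Matrix.specialUnitaryGroup (Fin 2) ℂ) (F.P K) (β - t) /
        partitionFn (G := Matrix.specialUnitaryGroup (Fin 2) ℂ) (F.P K) β := by
    calc ∫ U, Real.exp (c₀ * β * ∑ a : Plaq (F.P K) 0, dist1 (GaugeField.plaqHol U a) ^ 2) ∂(gibbsK F ℰp γ K)
        ≤ ∫ U, Real.exp (t * wilsonAction4 U) ∂(gibbsK F ℰp γ K) :=
          integral_mono_of_nonneg (ae_of_all _ fun U => (Real.exp_pos _).le) hint (ae_of_all _ hpt)
      _ = partitionFn (G := Matrix.specialUnitaryGroup (Fin 2) ℂ) (F.P K) (β - t) /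
            partitionFn (G := Matrix.specialUnitaryGroup (Fin 2) ℂ) (F.P K) β := by
          rw [gibbsK_eq, scheme_β_eq]
          exact integral_exp_mul_action_eq (F.P K) hβ0.le t
  -- Step 3: the ratio, by §1 at `N = 2`, `d = 3`, `β' = β − t ≥ β/2`
  have hβ'0 : 0 < β - t := by linarith
  have hβ'le : β - t ≤ β := by linarith
  have hZ : 0 < partitionFn (G := Matrix.specialUnitaryGroup (Fin 2) ℂ) (F.P K) β := partitionFn_pos' (F.P K) hβ0.le
  have hZ' : 0 < partitionFn (G := Matrix.specialUnitaryGroup (Fin 2) ℂ) (F.P K) (β - t) := partitionFn_pos' (F.P K) hβ'0.le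
  have hratio := hE (F.P K) β (β - t) hβ1 hβ'0 hβ'le
  have hd3 : ((F.P K).d : ℝ) = 3 := by rw [T3Family.P_d]; norm_num
  have ha : (((2 * 2 : ℕ) : ℝ) - 1) / 2 = 3 / 2 := by norm_num
  rw [hd3, ha, ← hr] at hratio
  have hlog2 : Real.log β - Real.log (β - t) ≤ Real.log 2 := by
    have h2 : β ≤ 2 * (β - t) := by linarith
    have := Real.log_le_log hβ0 h2
    rw [Real.log_mul two_ne_zero hβ'0.ne'] at this
    linarith
  have hlβ0 : 0 ≤ Real.log β := Real.log_nonneg hβ1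
  have hfin : Real.log (partitionFn (G := Matrix.specialUnitaryGroup (Fin 2) ℂ) (F.P K) (β - t)) -
      Real.log (partitionFn (G := Matrix.specialUnitaryGroup (Fin 2) ℂ) (F.P K) β) ≤
      (Real.log 2 + 3 * E) * nP + 3 / 2 * (nP * r) * Real.log β := by
    set V : ℝ := (Fintype.card (Site (F.P K) 0) : ℝ) with hV
    have e1 : 3 / 2 * (3 - 1) * V * (Real.log β - Real.log (β - t)) ≤ 3 * V * Real.log 2 := by
      have := mul_le_mul_of_nonneg_left hlog2 (by positivity : (0 : ℝ) ≤ 3 * V)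
      linarith
    have e2 : 3 / 2 * (3 : ℝ) * (V * r) * Real.log β = 3 / 2 * (3 * V * r) * Real.log β := by ring
    have e3 : E * (3 : ℝ) ^ 2 * V = 3 * E * (3 * V) := by ring
    rw [hnP3]
    linarith [hratio, e1, e2, e3]
  calc ∫ U, Real.exp (c₀ * β * ∑ a : Plaq (F.P K) 0, dist1 (GaugeField.plaqHol U a) ^ 2) ∂(gibbsK F ℰp γ K)
      ≤ partitionFn (G := Matrix.specialUnitaryGroup (Fin 2) ℂ) (F.P K) (β - t) /
          partitionFn (G := Matrix.specialUnitaryGroup (Fin 2) ℂ) (F.P K) β := hstep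
    _ = Real.exp (Real.log (partitionFn (G := Matrix.specialUnitaryGroup (Fin 2) ℂ) (F.P K) (β - t)) -
          Real.log (partitionFn (G := Matrix.specialUnitaryGroup (Fin 2) ℂ) (F.P K) β)) := by
        rw [Real.exp_sub, Real.exp_log hZ', Real.exp_log hZ]
    _ ≤ Real.exp ((Real.log 2 + 3 * E) * nP + 3 / 2 * (nP * r) * Real.log β) := Real.exp_le_exp.mpr hfin

/-- DOMINATION: a per-plaquette integrand `0 ≤ g_a(U) ≤ |U(∂a) − 1|²` inherits the bound of `exists_bareStiffness_le` (used for the capped tilt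
`min(|U(∂a) − 1|², θ²)` of the crux and the sub-threshold square `|U(∂a) − 1|²·1[|U(∂a) − 1| < θ]` of the BULK stub). [folklore] -/
theorem integral_exp_dominated_le {γ : ℝ} (hγ : 0 < γ) (K : ℕ) {c : ℝ} (hc : 0 ≤ c)
    (g : Plaq (F.P K) 0 → GaugeField (F.P K) 0 (Matrix.specialUnitaryGroup (Fin 2) ℂ) → ℝ)
    (hg : ∀ a U, g a U ≤ dist1 (GaugeField.plaqHol U a) ^ 2) {B : ℝ}
    (hB : ∫ U, Real.exp (c * ∑ a : Plaq (F.P K) 0, dist1 (GaugeField.plaqHol U a) ^ 2) ∂(gibbsK F ℰp γ K) ≤ B) :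
    ∫ U, Real.exp (c * ∑ a : Plaq (F.P K) 0, g a U) ∂(gibbsK F ℰp γ K) ≤ B := by
  haveI := isProbabilityMeasure_gibbsK F ℰp hγ.le K
  refine le_trans (integral_mono_of_nonneg (ae_of_all _ fun U => (Real.exp_pos _).le) ?_ (ae_of_all _ fun U => ?_)) hB
  · refine integrable_of_bounded (((measurable_sqSum F K).const_mul _).exp)
      (M := Real.exp (c * (4 * (Fintype.card (Plaq (F.P K) 0) : ℝ)))) fun U => ?_
    rw [abs_of_pos (Real.exp_pos _)]
    exact Real.exp_le_exp.mpr (mul_le_mul_of_nonneg_left (sqSum_mem F U).2 hc)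
  · exact Real.exp_le_exp.mpr (mul_le_mul_of_nonneg_left (Finset.sum_le_sum fun a _ => hg a U) hc)

/-- **★ THE BARE (`j = 0`) FACE OF THE CRUX WITH TOTAL LOGARITHMIC SLACK** (every profile `(b₀, p₀)`, the constant `A` of
`exists_bareStiffness_le`): `∫ exp(c₀·β_K·Σ_a min(|U(∂a) − 1|², θ(K)²)) dGibbs_K ≤ exp(A·#Plaq_0 + (3/2)·(#Plaq_0/n_K)·log β_K)`
for all `F`, `0 < γ ≤ 1`, `K`, `0 ≤ c₀ ≤ 1/8`. [folklore] -/
theorem exists_crux0_le :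
    ∃ A : ℝ, 0 ≤ A ∧ ∀ (F : T3Family) (γ b₀ p₀ : ℝ), 0 < γ → γ ≤ 1 → ∀ (K : ℕ) (c₀ : ℝ), 0 ≤ c₀ → c₀ ≤ 1 / 8 →
      ∫ U, Real.exp (c₀ * (γ * ((F.L : ℝ)⁻¹) ^ K)⁻¹ *
          ∑ a : Plaq (F.P K) 0, min (dist1 (GaugeField.plaqHol U a) ^ 2) (θBal F.L γ b₀ p₀ K ^ 2)) ∂(gibbsK F ℰp γ K) ≤
        Real.exp (A * (Fintype.card (Plaq (F.P K) 0) : ℝ) +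
          3 / 2 * ((Fintype.card (Plaq (F.P K) 0) : ℝ) * ((F.P K).sitesPerDir 0 : ℝ)⁻¹) * Real.log (γ * ((F.L : ℝ)⁻¹) ^ K)⁻¹) := by
  obtain ⟨A, hA0, hA⟩ := exists_bareStiffness_le
  refine ⟨A, hA0, fun F γ b₀ p₀ hγ hγ1 K c₀ hc₀ hc₀' => ?_⟩
  have hcβ : 0 ≤ c₀ * (γ * ((F.L : ℝ)⁻¹) ^ K)⁻¹ := mul_nonneg hc₀ (inv_nonneg.2 (mul_nonneg hγ.le (pow_nonneg (inv_nonneg.2 (Nat.cast_nonneg _)) K)))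
  have h := integral_exp_dominated_le F hγ K hcβ (fun a U => min (dist1 (GaugeField.plaqHol U a) ^ 2) (θBal F.L γ b₀ p₀ K ^ 2))
    (fun a U => min_le_left _ _) (hA F γ hγ hγ1 K c₀ hc₀ hc₀')
  simpa only [mul_assoc] using h

/-- **★ THE BARE (`j = 0`) FACE OF THE BULK STUB `stub_subThresholdStiffness` WITH TOTAL LOGARITHMIC SLACK** (every profile, same `A`):
`∫ exp(c₀·β_K·Σ_a |U(∂a) − 1|²·1[|U(∂a) − 1| < θ(K)]) dGibbs_K ≤ exp(A·#Plaq_0 + (3/2)·(#Plaq_0/n_K)·log β_K)`. [folklore] -/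
theorem exists_bulk0_le :
    ∃ A : ℝ, 0 ≤ A ∧ ∀ (F : T3Family) (γ b₀ p₀ : ℝ), 0 < γ → γ ≤ 1 → ∀ (K : ℕ) (c₀ : ℝ), 0 ≤ c₀ → c₀ ≤ 1 / 8 →
      ∫ U, Real.exp (c₀ * (γ * ((F.L : ℝ)⁻¹) ^ K)⁻¹ *
          ∑ a : Plaq (F.P K) 0, (if dist1 (GaugeField.plaqHol U a) < θBal F.L γ b₀ p₀ K then
            dist1 (GaugeField.plaqHol U a) ^ 2 else 0)) ∂(gibbsK F ℰp γ K) ≤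
        Real.exp (A * (Fintype.card (Plaq (F.P K) 0) : ℝ) +
          3 / 2 * ((Fintype.card (Plaq (F.P K) 0) : ℝ) * ((F.P K).sitesPerDir 0 : ℝ)⁻¹) * Real.log (γ * ((F.L : ℝ)⁻¹) ^ K)⁻¹) := by
  obtain ⟨A, hA0, hA⟩ := exists_bareStiffness_le
  refine ⟨A, hA0, fun F γ b₀ p₀ hγ hγ1 K c₀ hc₀ hc₀' => ?_⟩
  have hcβ : 0 ≤ c₀ * (γ * ((F.L : ℝ)⁻¹) ^ K)⁻¹ := mul_nonneg hc₀ (inv_nonneg.2 (mul_nonneg hγ.le (pow_nonneg (inv_nonneg.2 (Nat.cast_nonneg _)) K)))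
  have h := integral_exp_dominated_le F hγ K hcβ
    (fun a U => if dist1 (GaugeField.plaqHol U a) < θBal F.L γ b₀ p₀ K then dist1 (GaugeField.plaqHol U a) ^ 2 else 0)
    (fun a U => by
      show (if dist1 (GaugeField.plaqHol U a) < θBal F.L γ b₀ p₀ K then dist1 (GaugeField.plaqHol U a) ^ 2 else 0) ≤ _
      split_ifs
      · exact le_rfl
      · exact sq_nonneg _)
    (hA F γ hγ hγ1 K c₀ hc₀ hc₀')
  simpa only [mul_assoc] using h

/-- **★ THE MEAN ACTION WITH TOTAL LOGARITHMIC SLACK** (Jensen at `c₀ = 1/8`): `β_K·∫ Σ_a|U(∂a) − 1|² dGibbs_K ≤ 8A·#Plaq_0 + 12·(#Plaq_0/n_K)·log β_K`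
for all `F`, `0 < γ ≤ 1`, `K` — mean plaquette energy `O(1/β_K)` up to a correction vanishing along `K → ∞` at fixed `γ`; equivalently
(`A ≤ ½Σ|U(∂a) − 1|² ≤ 2A`) the mean Wilson action of the three-torus at inverse coupling `β_K`. [folklore] -/
theorem exists_meanSqSum_le :
    ∃ A : ℝ, 0 ≤ A ∧ ∀ (F : T3Family) (γ : ℝ), 0 < γ → γ ≤ 1 → ∀ (K : ℕ),
      (γ * ((F.L : ℝ)⁻¹) ^ K)⁻¹ * ∫ U, (∑ a : Plaq (F.P K) 0, dist1 (GaugeField.plaqHol U a) ^ 2) ∂(gibbsK F ℰp γ K) ≤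
        8 * A * (Fintype.card (Plaq (F.P K) 0) : ℝ) +
          12 * ((Fintype.card (Plaq (F.P K) 0) : ℝ) * ((F.P K).sitesPerDir 0 : ℝ)⁻¹) * Real.log (γ * ((F.L : ℝ)⁻¹) ^ K)⁻¹ := by
  obtain ⟨A, hA0, hA⟩ := exists_bareStiffness_le
  refine ⟨A, hA0, fun F γ hγ hγ1 K => ?_⟩
  set β : ℝ := (γ * ((F.L : ℝ)⁻¹) ^ K)⁻¹ with hβdef
  have hβ0 : 0 ≤ β := inv_nonneg.2 (mul_nonneg hγ.le (pow_nonneg (inv_nonneg.2 (Nat.cast_nonneg _)) K))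
  haveI := isProbabilityMeasure_gibbsK F ℰp hγ.le K
  have hb := hA F γ hγ hγ1 K (1 / 8) (by norm_num) le_rfl
  have hpos : 0 < ∫ U, Real.exp (1 / 8 * β * ∑ a : Plaq (F.P K) 0, dist1 (GaugeField.plaqHol U a) ^ 2) ∂(gibbsK F ℰp γ K) := by
    have hc : ∫ _U : GaugeField (F.P K) 0 (Matrix.specialUnitaryGroup (Fin 2) ℂ), (1 : ℝ) ∂(gibbsK F ℰp γ K) = 1 := by
      rw [integral_const, smul_eq_mul, mul_one, probReal_univ]
    have h1 : ∫ _U : GaugeField (F.P K) 0 (Matrix.specialUnitaryGroup (Fin 2) ℂ), (1 : ℝ) ∂(gibbsK F ℰp γ K) ≤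
        ∫ U, Real.exp (1 / 8 * β * ∑ a : Plaq (F.P K) 0, dist1 (GaugeField.plaqHol U a) ^ 2) ∂(gibbsK F ℰp γ K) := by
      refine integral_mono_of_nonneg (ae_of_all _ fun _ => zero_le_one) ?_ (ae_of_all _ fun U => ?_)
      · refine integrable_of_bounded (((measurable_sqSum F K).const_mul _).exp)
          (M := Real.exp (1 / 8 * β * (4 * (Fintype.card (Plaq (F.P K) 0) : ℝ)))) fun U => ?_
        rw [abs_of_pos (Real.exp_pos _)]
        have hb8 : (0 : ℝ) ≤ 1 / 8 * β := by positivity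
        exact Real.exp_le_exp.mpr (mul_le_mul_of_nonneg_left (sqSum_mem F U).2 hb8)
      · have hb8 : (0 : ℝ) ≤ 1 / 8 * β := by positivity
        exact Real.one_le_exp (mul_nonneg hb8 (sqSum_mem F U).1)
    rw [hc] at h1
    linarith
  have hJ : ∫ U, (1 / 8 * β * ∑ a : Plaq (F.P K) 0, dist1 (GaugeField.plaqHol U a) ^ 2) ∂(gibbsK F ℰp γ K) ≤
      Real.log (∫ U, Real.exp (1 / 8 * β * ∑ a : Plaq (F.P K) 0, dist1 (GaugeField.plaqHol U a) ^ 2) ∂(gibbsK F ℰp γ K)) :=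
    integral_le_log_integral_exp ((measurable_sqSum F K).const_mul _)
      (M := 1 / 8 * β * (4 * (Fintype.card (Plaq (F.P K) 0) : ℝ))) fun U => by
        obtain ⟨h0, h4⟩ := sqSum_mem F U
        rw [abs_of_nonneg (by positivity)]
        exact mul_le_mul_of_nonneg_left h4 (by positivity)
  have hlog := Real.log_le_log hpos hb
  rw [Real.log_exp] at hlog
  rw [integral_const_mul] at hJ
  linarith

end Bare
/-! ## §3 COMPACT COUPLING RANGES: the bare faces of the crux hold uniformly in the cut-off and the volume -/

section Compact

variable (F : T3Family)

/-- **THE LOGARITHMIC SLACK IS `O(n_K)` ON COMPACT COUPLING RANGES**: for `0 < γ_lo ≤ γ`,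
`log β_K = K·log L + log γ⁻¹ ≤ (1 + max(log γ_lo⁻¹, 0))·L^{m+K} = (1 + max(log γ_lo⁻¹, 0))·n_K/2` (`K log L ≤ L^{K+1} ≤ L^{m+K}` as `m ≥ 1`). [folklore] -/
theorem log_beta_le {γlo γ : ℝ} (hγlo : 0 < γlo) (hle : γlo ≤ γ) (K : ℕ) :
    Real.log (γ * ((F.L : ℝ)⁻¹) ^ K)⁻¹ ≤ (1 + max (Real.log γlo⁻¹) 0) / 2 * ((F.P K).sitesPerDir 0 : ℝ) := by
  have hγ : 0 < γ := lt_of_lt_of_le hγlo hle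
  have hL2 : (2 : ℝ) ≤ F.L := by exact_mod_cast F.hL.2
  have hL0 : (0 : ℝ) < F.L := by linarith
  have hn : ((F.P K).sitesPerDir 0 : ℝ) = 2 * (F.L : ℝ) ^ (F.m + K) := by
    have h : (F.P K).sitesPerDir 0 = 2 * F.L ^ (F.m + K) := by
      simp [T3Family.P, Balaban1985CMP102.Setting.params3, Params.sitesPerDir]
    rw [h]; push_cast; ring
  -- `log β_K = K log L + log γ⁻¹`
  have hlog : Real.log (γ * ((F.L : ℝ)⁻¹) ^ K)⁻¹ = K * Real.log F.L + Real.log γ⁻¹ := by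
    rw [Real.log_inv, Real.log_mul hγ.ne' (pow_ne_zero _ (inv_ne_zero hL0.ne')), Real.log_pow, Real.log_inv, Real.log_inv]
    ring
  -- `K log L ≤ L^{m+K}`
  have hK : (K : ℝ) * Real.log F.L ≤ (F.L : ℝ) ^ (F.m + K) := by
    have h1 : (K : ℝ) ≤ (F.L : ℝ) ^ K := by
      have h2 : (K : ℝ) < 2 ^ K := by exact_mod_cast Nat.lt_two_pow_self
      exact h2.le.trans (pow_le_pow_left₀ (by norm_num) hL2 K)
    have h3 : Real.log F.L ≤ (F.L : ℝ) := (Real.log_le_sub_one_of_pos hL0).trans (by linarith)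
    have h4 : (F.L : ℝ) ^ K * (F.L : ℝ) ≤ (F.L : ℝ) ^ (F.m + K) := by
      rw [← pow_succ]
      exact pow_le_pow_right₀ (by linarith) (by have := F.hm; omega)
    calc (K : ℝ) * Real.log F.L ≤ (F.L : ℝ) ^ K * (F.L : ℝ) :=
          mul_le_mul h1 h3 (Real.log_nonneg (by linarith)) (pow_nonneg hL0.le K)
      _ ≤ (F.L : ℝ) ^ (F.m + K) := h4
  -- `log γ⁻¹ ≤ max(log γ_lo⁻¹, 0)·L^{m+K}`
  have hpow1 : (1 : ℝ) ≤ (F.L : ℝ) ^ (F.m + K) := one_le_pow₀ (by linarith)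
  have hγlog : Real.log γ⁻¹ ≤ max (Real.log γlo⁻¹) 0 * (F.L : ℝ) ^ (F.m + K) := by
    have h1 : Real.log γ⁻¹ ≤ Real.log γlo⁻¹ := Real.log_le_log (inv_pos.2 hγ) (inv_anti₀ hγlo hle)
    have h2 : Real.log γlo⁻¹ ≤ max (Real.log γlo⁻¹) 0 := le_max_left _ _
    have h3 : max (Real.log γlo⁻¹) 0 ≤ max (Real.log γlo⁻¹) 0 * (F.L : ℝ) ^ (F.m + K) :=
      le_mul_of_one_le_right (le_max_right _ _) hpow1
    linarith
  rw [hlog, hn]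
  nlinarith [hK, hγlog, le_max_right (Real.log γlo⁻¹) 0]

/-- The slack term on a compact coupling range: `w·(#Plaq_0/n_K)·log β_K ≤ (w/2)(1 + max(log γ_lo⁻¹, 0))·#Plaq_0` (`w ≥ 0`). [folklore] -/
theorem slack_le {γlo γ : ℝ} (hγlo : 0 < γlo) (hle : γlo ≤ γ) (K : ℕ) {w : ℝ} (hw : 0 ≤ w) :
    w * ((Fintype.card (Plaq (F.P K) 0) : ℝ) * ((F.P K).sitesPerDir 0 : ℝ)⁻¹) * Real.log (γ * ((F.L : ℝ)⁻¹) ^ K)⁻¹ ≤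
      w / 2 * (1 + max (Real.log γlo⁻¹) 0) * (Fintype.card (Plaq (F.P K) 0) : ℝ) := by
  have hn0 : (0 : ℝ) < ((F.P K).sitesPerDir 0 : ℝ) := by exact_mod_cast Nat.pos_of_ne_zero ((F.P K).sitesPerDir_ne_zero 0)
  have h1 := mul_le_mul_of_nonneg_left (log_beta_le F hγlo hle K) (by positivity :
    (0 : ℝ) ≤ w * ((Fintype.card (Plaq (F.P K) 0) : ℝ) * ((F.P K).sitesPerDir 0 : ℝ)⁻¹))
  have h2 : w * ((Fintype.card (Plaq (F.P K) 0) : ℝ) * ((F.P K).sitesPerDir 0 : ℝ)⁻¹) *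
      ((1 + max (Real.log γlo⁻¹) 0) / 2 * ((F.P K).sitesPerDir 0 : ℝ)) =
      w / 2 * (1 + max (Real.log γlo⁻¹) 0) * (Fintype.card (Plaq (F.P K) 0) : ℝ) := by
    field_simp
  linarith

/-- **★★ THE BARE FACE OF THE CRUX ON COMPACT COUPLING RANGES.**  For every `γ_lo > 0` there are `c₀ > 0` and `C₀` such that for EVERY
three-torus family `F` (any `L`, any volume exponent `m`), every `γ_lo ≤ γ ≤ 1`, every profile `(b₀, p₀)` and EVERY cut-off `K`:
`∫ exp(c₀·β_K·Σ_a min(|U(∂a) − 1|², θ(K)²)) dGibbs_K ≤ exp(C₀·#Plaq_0)` — the `j = 0` instance of `CappedCoarseStiffnessL` (25301) with the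
crux's uniformity in `K` and `m`, on every compact range of couplings; only the uniformity `γ → 0` at fixed lattice (the uniform Laplace
exponent of the g2/g12 memos) is not asserted. [folklore] -/
theorem crux0_compactCoupling (γlo : ℝ) (hγlo : 0 < γlo) :
    ∃ (c₀ C₀ : ℝ), 0 < c₀ ∧ ∀ (F : T3Family) (γ b₀ p₀ : ℝ), γlo ≤ γ → γ ≤ 1 → ∀ (K : ℕ),
      ∫ U, Real.exp (c₀ * (γ * ((F.L : ℝ)⁻¹) ^ K)⁻¹ *
          ∑ a : Plaq (F.P K) 0, min (dist1 (GaugeField.plaqHol U a) ^ 2) (θBal F.L γ b₀ p₀ K ^ 2)) ∂(gibbsK F ℰp γ K) ≤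
        Real.exp (C₀ * (Fintype.card (Plaq (F.P K) 0) : ℝ)) := by
  obtain ⟨A, hA0, hA⟩ := exists_crux0_le
  refine ⟨1 / 8, A + 3 / 4 * (1 + max (Real.log γlo⁻¹) 0), by norm_num, fun F γ b₀ p₀ hle hγ1 K => ?_⟩
  have hγ : 0 < γ := lt_of_lt_of_le hγlo hle
  refine (hA F γ b₀ p₀ hγ hγ1 K (1 / 8) (by norm_num) le_rfl).trans (Real.exp_le_exp.mpr ?_)
  have hP0 : (0 : ℝ) ≤ (Fintype.card (Plaq (F.P K) 0) : ℝ) := Nat.cast_nonneg _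
  have key := slack_le F hγlo hle K (by norm_num : (0 : ℝ) ≤ 3 / 2)
  nlinarith [key, hP0]

/-- **★★ THE BARE FACE OF THE BULK STUB ON COMPACT COUPLING RANGES** (`stub_subThresholdStiffness` at `j = 0`, uniformly in `K`, `m`,
`γ ∈ [γ_lo, 1]`, every profile). [folklore] -/
theorem bulk0_compactCoupling (γlo : ℝ) (hγlo : 0 < γlo) :
    ∃ (c₀ C₀ : ℝ), 0 < c₀ ∧ ∀ (F : T3Family) (γ b₀ p₀ : ℝ), γlo ≤ γ → γ ≤ 1 → ∀ (K : ℕ),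
      ∫ U, Real.exp (c₀ * (γ * ((F.L : ℝ)⁻¹) ^ K)⁻¹ *
          ∑ a : Plaq (F.P K) 0, (if dist1 (GaugeField.plaqHol U a) < θBal F.L γ b₀ p₀ K then
            dist1 (GaugeField.plaqHol U a) ^ 2 else 0)) ∂(gibbsK F ℰp γ K) ≤
        Real.exp (C₀ * (Fintype.card (Plaq (F.P K) 0) : ℝ)) := by
  obtain ⟨A, hA0, hA⟩ := exists_bulk0_le
  refine ⟨1 / 8, A + 3 / 4 * (1 + max (Real.log γlo⁻¹) 0), by norm_num, fun F γ b₀ p₀ hle hγ1 K => ?_⟩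
  have hγ : 0 < γ := lt_of_lt_of_le hγlo hle
  refine (hA F γ b₀ p₀ hγ hγ1 K (1 / 8) (by norm_num) le_rfl).trans (Real.exp_le_exp.mpr ?_)
  have hP0 : (0 : ℝ) ≤ (Fintype.card (Plaq (F.P K) 0) : ℝ) := Nat.cast_nonneg _
  have key := slack_le F hγlo hle K (by norm_num : (0 : ℝ) ≤ 3 / 2)
  nlinarith [key, hP0]

/-- **★★ THE UNCAPPED BARE STIFFNESS ON COMPACT COUPLING RANGES**: `∫ exp(c₀·β_K·Σ_a |U(∂a) − 1|²) dGibbs_K ≤ exp(C₀·#Plaq_0)`, uniformly in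
`K`, `m`, `γ ∈ [γ_lo, 1]` (`c₀ = 1/8`). [folklore] -/
theorem ubs_compactCoupling (γlo : ℝ) (hγlo : 0 < γlo) :
    ∃ (c₀ C₀ : ℝ), 0 < c₀ ∧ ∀ (F : T3Family) (γ : ℝ), γlo ≤ γ → γ ≤ 1 → ∀ (K : ℕ),
      ∫ U, Real.exp (c₀ * (γ * ((F.L : ℝ)⁻¹) ^ K)⁻¹ * ∑ a : Plaq (F.P K) 0, dist1 (GaugeField.plaqHol U a) ^ 2) ∂(gibbsK F ℰp γ K) ≤
        Real.exp (C₀ * (Fintype.card (Plaq (F.P K) 0) : ℝ)) := by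
  obtain ⟨A, hA0, hA⟩ := exists_bareStiffness_le
  refine ⟨1 / 8, A + 3 / 4 * (1 + max (Real.log γlo⁻¹) 0), by norm_num, fun F γ hle hγ1 K => ?_⟩
  have hγ : 0 < γ := lt_of_lt_of_le hγlo hle
  refine (hA F γ hγ hγ1 K (1 / 8) (by norm_num) le_rfl).trans (Real.exp_le_exp.mpr ?_)
  have hP0 : (0 : ℝ) ≤ (Fintype.card (Plaq (F.P K) 0) : ℝ) := Nat.cast_nonneg _
  have key := slack_le F hγlo hle K (by norm_num : (0 : ℝ) ≤ 3 / 2)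
  nlinarith [key, hP0]

/-- **★★ UNIFORM MEAN ACTION ON COMPACT COUPLING RANGES**: `β_K·∫ Σ_a|U(∂a) − 1|² dGibbs_K ≤ C·#Plaq_0` for all `F`, `γ ∈ [γ_lo, 1]`, `K` —
mean plaquette energy `O(1/β_K)` on ALL of Bałaban's three-tori, uniformly in the cut-off and the volume, at every fixed terminal coupling. [folklore] -/
theorem uma_compactCoupling (γlo : ℝ) (hγlo : 0 < γlo) :
    ∃ C : ℝ, ∀ (F : T3Family) (γ : ℝ), γlo ≤ γ → γ ≤ 1 → ∀ (K : ℕ),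
      (γ * ((F.L : ℝ)⁻¹) ^ K)⁻¹ * ∫ U, (∑ a : Plaq (F.P K) 0, dist1 (GaugeField.plaqHol U a) ^ 2) ∂(gibbsK F ℰp γ K) ≤
        C * (Fintype.card (Plaq (F.P K) 0) : ℝ) := by
  obtain ⟨A, hA0, hA⟩ := exists_meanSqSum_le
  refine ⟨8 * A + 6 * (1 + max (Real.log γlo⁻¹) 0), fun F γ hle hγ1 K => ?_⟩
  have hγ : 0 < γ := lt_of_lt_of_le hγlo hle
  refine (hA F γ hγ hγ1 K).trans ?_
  have hP0 : (0 : ℝ) ≤ (Fintype.card (Plaq (F.P K) 0) : ℝ) := Nat.cast_nonneg _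
  have key := slack_le F hγlo hle K (by norm_num : (0 : ℝ) ≤ 12)
  nlinarith [key, hP0]

end Compact


end Summit.QuantumFields.YangMills.Theorems.CoarseStiffnessTailBareCompactCoupling

end
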